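import Literature.NumberTheory.EllipticCurves.SelmerCorankControlRatProofs
import Literature.NumberTheory.EllipticCurves.IwasawaSelmerControlLocalInputsProofs
import Literature.NumberTheory.EllipticCurves.PeriodIndexSupportProofs
import Literature.NumberTheory.EllipticCurves.ZpExtensionUnramifiedProofs
import HarnessLib

/-!
# `rank_{ℤ_p} X(E/ℚ_∞)_Γ = corank_{ℤ_p} Sel_{p^∞}(E/ℚ)`: reduction to the layer `n = 0`

Sibling proof file of `Literature.NumberTheory.EllipticCurves.SelmerCorankControl` (statement file
untouched; **no definition and no named fact is introduced**, everything below is proved),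
continuing `SelmerCorankControlRatProofs`. That file reduces the named fact
`Literature.NumberTheory.EllipticCurves.Greenberg1999_coinvariantsRank_eq_selmerCorank_rat`
(Greenberg, LNM 1716, Thm. 1.2 with §1 pp. 60, 65 of the held copy
`book:coates1999-arithmetic-theory-elliptic-curves`: for `E/ℚ` with good ordinary reduction at `p`
and the cyclotomic `ℤ_p`-extension, `X/TX` is finitely generated over `ℤ_p` of rank
`corank_{ℤ_p} Sel_E(ℚ)_p`) to Mazur's control theorem, and thence to its one unproved input,
Greenberg's Lemma 3.5 (`WeierstrassCurve.Greenberg1999_kerG_bounded`: `#ker g_n` bounded for ALL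
`n`, over every number field). The identity itself only sees the layer `n = 0`
(`WeierstrassCurve.finite_and_coinvariantsRank_eq_selmerCorank_of_finite_coker` needs
`coker(s_0 : Sel_E(K)_p → Sel_E(K_∞)_p^Γ)` finite, and `coker s_0` is a quotient of `ker g_0` by
Lemmas 3.1–3.2, both proved in the tree), so much less than Lemma 3.5 is needed. This file records
the sharper reduction and discharges the part of the level-`0` local analysis that the tree
already affords:

* `Greenberg1999_coinvariantsRank_eq_selmerCorank_rat_of_finite_kerG_zero`: the `K = ℚ` fact
  follows from the FINITENESS of `ker g_0 = A_0 / Sel_{p^∞}(E/ℚ)` alone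
  (`A_0 = h_0⁻¹(Sel_{p^∞}(E/ℚ_∞)) ⊆ H¹(ℚ, E[p^∞])`), for `E/ℚ` elliptic with good ordinary
  reduction at `p` and `κ` cyclotomic (Greenberg, p. 86, the snake sequence
  `0 → ker(s_n) → ker(h_n) → ker(g_n) → coker(s_n) → coker(h_n)`, and p. 90: "Lemmas 3.2 and 3.5
  show that `coker(s_n)` is finite and of bounded order", read at `n = 0` without "bounded").
* `WeierstrassCurve.finite_kerG_zero_of_localTowerKerPrimary` (any number field `K`, any
  `ℤ_p`-extension): `A_0 / Sel_0` is finite as soon as the `p`-power torsion `𝒦_{v,0}[p^∞]` of the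
  level-`0` local tower kernels `𝒦_{v,0} = ker (H¹(K_v, E) → H¹(K_{∞,η}, E))`
  (`localTowerKerPrimary`, file `IwasawaSelmerControlLocalizationProofs`) vanishes off a finite
  set `S` of finite places and is finite on `S` — the level-`0` case of Greenberg's proof of
  Lemma 3.5 (p. 90), where the covering hypothesis is void (`Gal(K̄/K_0) = Γ_K`).
* `WeierstrassCurve.localTowerKer_zero_eq_bot_of_hasGoodReductionAt` (any `K`, any `κ`): **at a
  place `v ∤ p` of good reduction the level-`0` local tower kernel vanishes**, `𝒦_{v,0} = 0`
  (Greenberg, Lemma 3.3, second part, p. 87: "Now assume that `E` has good reduction at `v` …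
  Therefore, `ker(r_{v_n}) = 0`", case `n = 0`). The printed proof goes through `B_v` divisible
  and `Im κ_v = 0` (Prop. 2.1); here, at `n = 0`, it is read off Lang–Tate instead: a class of
  `H¹(K_v, E)` dying on `H_{v,∞} = Gal(K̄_v/K_{∞,η})` is represented by a cocycle vanishing on
  `H_{v,∞} ⊇ I_v` (every `ℤ_p`-extension is unramified at `v ∤ p`:
  `ZpExtension.inertia_le_kerSubgroup_holds`, with `resGalOfEmb_mem_inertia_primeBelow`), hence
  is zero by Milne, *ADT*, Prop. I.3.8 (`H¹(K_v^{un}/K_v, E(K_v^{un})) = 0` at good reduction; tree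
  theorem `Milne2006_unramifiedClass_eq_zero_holds`).
* `WeierstrassCurve.finite_kerG_zero_of_local_finiteness` and
  `Greenberg1999_coinvariantsRank_eq_selmerCorank_rat_of_local_finiteness`: consequently the
  `K = ℚ` fact follows from the finiteness of `𝒦_{v,0}[p^∞]` at the finitely many places `v` of
  bad reduction with `v ∤ p` (Lemma 3.3, eq. (4), p. 87, at `n = 0`) and at `v ∣ p` (Lemma 3.4,
  p. 89, at `n = 0`: good ordinary reduction, `K_{∞,η}/ℚ_p` the cyclotomic `ℤ_p`-extension).

## What remains for `Greenberg1999_coinvariantsRank_eq_selmerCorank_rat_holds`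

Exactly the two hypotheses of `Greenberg1999_coinvariantsRank_eq_selmerCorank_rat_of_local_finiteness`,
both statements about `E` over a single completion `ℚ_ℓ` and its `ℤ_p`-tower `ℚ_{ℓ,∞}` at level
`0` (no uniformity in `n`, no finite extensions of `ℚ` other than the layers of `ℚ_{ℓ,∞}/ℚ_ℓ`):
(a) bad `ℓ ≠ p`: `ker(H¹(ℚ_ℓ, E) → H¹(ℚ_{ℓ,∞}, E))[p^∞]` finite (`ℚ_{ℓ,∞}` the unramified
`ℤ_p`-extension; Lutz over the unramified extensions of `ℚ_ℓ`, or Tate local duality over `ℚ_ℓ`);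
(b) `ℓ = p` good ordinary: `ker(H¹(ℚ_p, E) → H¹(ℚ_{p,∞}, E))[p^∞]` finite (Greenberg's Lemma 3.4
at `n = 0`, `#ker(r_v) = #Ẽ(𝔽_p)(p)²`; the ordinary local theory, Props. 2.2, 2.4). Neither is in
the tree (2026-08-15); the general Lemma 3.5 (`Greenberg1999_kerG_bounded`) implies both
(`Greenberg1999_coinvariantsRank_eq_selmerCorank_rat_of_kerG_bounded`).

## References

* [GreenbergLNM1716] R. Greenberg, *Iwasawa theory for elliptic curves*, in: Arithmetic Theory
  of Elliptic Curves (Cetraro 1997), LNM 1716 (1999), Thm. 1.2, §1 pp. 60, 65; §3 pp. 85–90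
  (Lemmas 3.1–3.5); §2 Prop. 2.1 (p. 72).
* [MilneADT2006] J. S. Milne, *Arithmetic Duality Theorems*, 2nd ed. (2006), Ch. I Prop. 3.8.
* [Washington1997] L. C. Washington, *Introduction to Cyclotomic Fields*, Prop. 13.2.
* [MazurInvent1972] B. Mazur, Invent. Math. 18 (1972), 183–266, §6.
-/

noncomputable section

open scoped Classical

open NumberField IsDedekindDomain

universe u

namespace WeierstrassCurve

open Literature.NumberTheory.EllipticCurves Literature.NumberTheory.GaloisRepresentations
  IsDedekindDomain.HeightOneSpectrum

variable {K : Type u} [Field K] [NumberField K] (W : WeierstrassCurve K) {p : ℕ} [Fact p.Prime]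
  (κ : ZpExtension K p)

/-! ## Good places `v ∤ p`: the level-`0` local tower kernel vanishes (Lang–Tate) -/

/-- **Greenberg's Lemma 3.3, second part, at the layer `n = 0`: `𝒦_{v,0} = 0` for good `v ∤ p`.**
For an elliptic curve `E` over a number field `K`, ANY `ℤ_p`-extension `κ` (`K_∞ = K̄^{ker κ}`),
and a finite place `v ∤ p` of good reduction, the local tower kernel
`𝒦_{v,0} = ker (H¹(H_{v,0}, E(K̄_v)) → H¹(H_{v,∞}, E(K̄_v)))`, `H_{v,0} = Γ_{K_v}`,
`H_{v,∞} = Gal(K̄_v/K_{∞,η})`, is trivial. Proof: a class in the kernel is represented by a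
continuous cocycle `φ'` of `Γ_{K_v}` vanishing on `H_{v,∞}` (subtract the coboundary trivialising
it there); `K_∞/K` is unramified at `v` (`ZpExtension.inertia_le_kerSubgroup_holds`, Washington
Prop. 13.2), so the local inertia group `I_𝔐 ≤ Γ_{K_v}` — which restricts into the global inertia
group of the prime below (`resGalOfEmb_mem_inertia_primeBelow`) — lies in `H_{v,∞}` and `φ'`
vanishes on it; by Milne, *ADT*, Prop. I.3.8 (`Milne2006_unramifiedClass_eq_zero_holds`:
`H¹(K_v^{un}/K_v, E(K_v^{un})) = 0` at good reduction) its class is `0`. Greenberg, LNM 1716, §3,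
Lemma 3.3 (p. 86; proof p. 87: "Now assume that `E` has good reduction at `v` …
`ker(r_{v_n}) = 0`"), case `n = 0`. [cite: GreenbergLNM1716, §3 Lemma 3.3 (pp. 86–87)]
[cite: MilneADT2006, Ch. I Prop. 3.8] -/
theorem localTowerKer_zero_eq_bot_of_hasGoodReductionAt [W.IsElliptic]
    (v : HeightOneSpectrum (𝓞 K)) (hpv : (p : 𝓞 K) ∉ v.asIdeal) (hgood : W.HasGoodReductionAt v) :
    W.localTowerKer κ (v.adicCompletion K) 0 = ⊥ := by
  -- notation
  let G : Type u := Field.absoluteGaloisGroup (v.adicCompletion K)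
  let P : Type u := localPoints W (v.adicCompletion K)
  let H0 : Subgroup G := localSubgroup (κ.layerSubgroup 0) (v.adicCompletion K)
  let Hi : Subgroup G := localSubgroup κ.kerSubgroup (v.adicCompletion K)
  have hle : Hi ≤ H0 := localSubgroup_ker_le_layer κ (v.adicCompletion K) 0
  have hmem0 : ∀ σ : G, σ ∈ H0 := fun σ ↦ by
    change σ ∈ localSubgroup (κ.layerSubgroup 0) (v.adicCompletion K)
    rw [mem_localSubgroup_iff, ZpExtension.layerSubgroup_zero]
    exact Subgroup.mem_top _
  -- the canonical section `Γ_{K_v} → H_{v,0}` (`H_{v,0} = Γ_{K_v}`)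
  let e : G →ₜ* H0 :=
    { toFun := fun σ ↦ ⟨σ, hmem0 σ⟩
      map_one' := rfl
      map_mul' := fun _ _ ↦ rfl
      continuous_toFun := continuous_id.subtype_mk _ }
  -- local inertia lies in `H_{v,∞}`: `ℤ_p`-extensions are unramified at `v ∤ p`
  obtain ⟨𝔐, h𝔐⟩ := v.localPrimesAbove_nonempty
  have hI : ∀ σ ∈ 𝔐.inertia G, σ ∈ Hi := fun σ hσ ↦
    (mem_localSubgroup_iff _ _ σ).mpr
      (ZpExtension.inertia_le_kerSubgroup_holds K p κ hpv (primeBelow_mem_primesAbove h𝔐)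
        (v.resGalOfEmb_mem_inertia_primeBelow (closureEmb (K := K) (v.adicCompletion K)) 𝔐 hσ))
  -- orbit maps on `H_{v,0}` are continuous
  have hcont : ∀ m : P, Continuous fun g : H0 ↦ g • m := fun m ↦
    (continuous_smul_localPoints W (v.adicCompletion K) m).comp continuous_subtype_val
  rw [eq_bot_iff]
  intro x hx
  rw [AddSubgroup.mem_bot]
  have hres := (W.mem_localTowerKer_iff κ (v.adicCompletion K) 0 x).mp hx
  obtain ⟨φ, rfl⟩ := oneCocycleClass_surjective _ x
  -- `res [φ] = 0` on `H_{v,∞}`: `φ = ∂Q` there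
  have hres' : oneCocycleClass _ (contOneCocycles.pullback (subgroupInclusion hle)
      (resHomOfEquivariant (subgroupInclusion hle) (AddMonoidHom.id P) (fun _ _ ↦ rfl)) φ) = 0 := by
    rw [← map_oneCocycleClass]; exact hres
  rw [oneCocycleClass_eq_zero_iff] at hres'
  obtain ⟨Q, hQ⟩ := hres'
  -- `φ' = φ - ∂Q` vanishes on `H_{v,∞}`
  set φ' := φ - cobCocycle Q (hcont Q) with hφ'
  have hφ'van : ∀ (τ : G) (hτ : τ ∈ Hi), φ'.1 ⟨τ, hle hτ⟩ = 0 := by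
    intro τ hτ
    have h : φ.1 ⟨τ, hle hτ⟩ = (⟨τ, hτ⟩ : Hi) • Q - Q := hQ ⟨τ, hτ⟩
    rw [hφ', Submodule.coe_sub, ContinuousMap.sub_apply, cobCocycle_apply, sub_eq_zero]
    exact h
  have hcls : oneCocycleClass _ φ = oneCocycleClass _ φ' := by
    rw [hφ', oneCocycleClass_sub, oneCocycleClass_cobCocycle, sub_zero]
  -- transport `φ'` to a cocycle of `Γ_{K_v}` vanishing on the inertia group
  let f : contOneCocycles (discreteTopRep G P) :=
    contOneCocycles.pullback e (resHomOfEquivariant e (AddMonoidHom.id P) (fun _ _ ↦ rfl)) φ'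
  have hf : ∀ σ ∈ 𝔐.inertia G, f.1 σ = 0 := fun σ hσ ↦ hφ'van σ (hI σ hσ)
  -- Lang–Tate / Milne ADT I.3.8
  have hzero := Milne2006_unramifiedClass_eq_zero_holds W v hgood h𝔐 f hf
  rw [oneCocycleClass_eq_zero_iff] at hzero
  obtain ⟨R, hR⟩ := hzero
  rw [hcls, oneCocycleClass_eq_zero_iff]
  exact ⟨R, fun g ↦ hR (g : G)⟩

/-- **`𝒦_{v,0}[p^∞] = 0` for good `v ∤ p`** (the `p`-power torsion of the level-`0` local tower
kernel, input (h0) of the localisation step at `n = 0`). Greenberg, LNM 1716, §3, Lemma 3.3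
(p. 86; proof p. 87), case `n = 0`. [cite: GreenbergLNM1716, §3 Lemma 3.3 (pp. 86–87)] -/
theorem localTowerKerPrimary_zero_eq_bot_of_hasGoodReductionAt [W.IsElliptic]
    (v : HeightOneSpectrum (𝓞 K)) (hpv : (p : 𝓞 K) ∉ v.asIdeal) (hgood : W.HasGoodReductionAt v) :
    W.localTowerKerPrimary κ (v.adicCompletion K) 0 = ⊥ :=
  le_bot_iff.mp ((W.localTowerKerPrimary_le_localTowerKer κ (v.adicCompletion K) 0).trans
    (W.localTowerKer_zero_eq_bot_of_hasGoodReductionAt κ v hpv hgood).le)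

/-! ## The layer `n = 0` of the localisation step -/

/-- **Finiteness of `ker g_0 = A_0 / Sel_{p^∞}(E/K)` from the level-`0` local tower kernels** (the
case `n = 0` of Greenberg's proof of Lemma 3.5, p. 90, where no count of primes above `v` is
needed: `Gal(K̄/K_0) = Γ_K`). Let `E` be an elliptic curve over a number field `K`, `κ` any
`ℤ_p`-extension, `A_0 = h_0⁻¹(Sel_{p^∞}(E/K_∞)) ⊆ H¹(K_0, E[p^∞])`. If the `p`-power torsion
`𝒦_{v,0}[p^∞]` of the local tower kernel vanishes at the finite places `v ∉ S` and is finite at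
`v ∈ S`, then `A_0 / Sel_{p^∞}(E/K_0)` is finite: the evaluation map
`Φ : A_0 → ∏_{v ∈ S} H¹(H_{v,0}, E(K̄_v))`, `y ↦ (loc_v y)_v`, takes values in the finite group
`∏_{v ∈ S} 𝒦_{v,0}[p^∞]` (`localResOver_conjH1_mem_localTowerKer_of_mem`; classes of
`H¹(K_0, E[p^∞])` are `p`-power torsion) and `ker Φ ⊆ Sel_{p^∞}(E/K_0)`
(`mem_selmerLayer_of_forall_localResOver_conjH1_eq_zero` with the single representative `ρ = 1`).
[cite: GreenbergLNM1716, §3 Lemma 3.5 (proof, p. 90)] -/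
theorem finite_kerG_zero_of_localTowerKerPrimary (S : Finset (HeightOneSpectrum (𝓞 K)))
    (h0 : ∀ v ∉ S, W.localTowerKerPrimary κ (v.adicCompletion K) 0 = ⊥)
    (hS : ∀ v ∈ S, Finite (W.localTowerKerPrimary κ (v.adicCompletion K) 0)) :
    Finite (↥(W.selmerInftyPreimage κ 0) ⧸
      (W.selmerLayer κ 0).addSubgroupOf (W.selmerInftyPreimage κ 0)) := by
  set A := W.selmerInftyPreimage κ 0 with hA
  -- the evaluation map `Φ y = (loc_v y)_{v ∈ S}`
  let Φ : ↥A →+ (Π v : ↥S, discreteH1 (localSubgroup (κ.layerSubgroup 0) (v.1.adicCompletion K))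
      (localPoints W (v.1.adicCompletion K))) :=
    AddMonoidHom.pi fun v ↦
      ((W.localResOver p (κ.layerSubgroup 0) (v.1.adicCompletion K)).comp
        (W.conjH1 p (κ.layerSubgroup 0) 1)).comp A.subtype
  have hΦ : ∀ (y : ↥A) (v : ↥S), Φ y v = W.localResOver p (κ.layerSubgroup 0)
      (v.1.adicCompletion K) (W.conjH1 p (κ.layerSubgroup 0) 1 (y : W.subgroupH1 p _)) :=
    fun y v ↦ rfl
  -- `ker Φ ⊆ Sel_0` (covering hypothesis void at `n = 0`: `σ = 1 · 1 · σ`, `σ ∈ Gal(K̄/K_0) = Γ_K`)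
  have hker : Φ.ker ≤ (W.selmerLayer κ 0).addSubgroupOf A := by
    intro y hy
    rw [AddSubgroup.mem_addSubgroupOf]
    refine W.mem_selmerLayer_of_forall_localResOver_conjH1_eq_zero κ S h0 (fun _ ↦ {1})
      (fun v _ σ ↦ ⟨1, Finset.mem_singleton_self 1, 1, σ, ?_, by rw [map_one, one_mul, one_mul]⟩)
      y.2 fun v hv ρ hρ ↦ ?_
    · rw [ZpExtension.layerSubgroup_zero]; exact Subgroup.mem_top σ
    · rw [Finset.mem_singleton] at hρ
      subst hρ
      have := congrFun ((AddMonoidHom.mem_ker).mp hy) ⟨v, hv⟩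
      rw [hΦ] at this
      exact this
  -- the values of `Φ` lie in `∏ 𝒦_{v,0}[p^∞]`
  have hval : ∀ (y : ↥A) (v : ↥S),
      Φ y v ∈ W.localTowerKerPrimary κ (v.1.adicCompletion K) 0 := by
    intro y v
    obtain ⟨k, hk⟩ := W.exists_pow_smul_subgroupH1_layer_eq_zero κ 0 (y : W.subgroupH1 p _)
    rw [hΦ]
    exact ⟨W.localResOver_conjH1_mem_localTowerKer_of_mem κ y.2 _ _, k, by
      rw [← map_nsmul, ← map_nsmul, hk, map_zero, map_zero]⟩
  -- finiteness
  haveI hfin : ∀ v : ↥S, Finite (W.localTowerKerPrimary κ (v.1.adicCompletion K) 0) :=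
    fun v ↦ hS _ v.2
  let g : Φ.range → Π v : ↥S, ↥(W.localTowerKerPrimary κ (v.1.adicCompletion K) 0) :=
    fun x v ↦ ⟨x.1 v, by obtain ⟨y, hy⟩ := x.2; rw [← hy]; exact hval y v⟩
  have hg : Function.Injective g := by
    rintro ⟨x, hx⟩ ⟨x', hx'⟩ h
    refine Subtype.ext (funext fun v ↦ ?_)
    have := congrFun h v
    simpa [g] using this
  haveI : Finite Φ.range := Finite.of_injective g hg
  haveI : Finite (↥A ⧸ Φ.ker) :=
    Finite.of_equiv _ (QuotientAddGroup.quotientKerEquivRange Φ).toEquiv.symm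
  -- `A ⧸ ker Φ ↠ A ⧸ Sel_0`
  let π : ↥A ⧸ Φ.ker →+ ↥A ⧸ (W.selmerLayer κ 0).addSubgroupOf A :=
    QuotientAddGroup.map Φ.ker ((W.selmerLayer κ 0).addSubgroupOf A) (AddMonoidHom.id _)
      (by rwa [AddSubgroup.comap_id])
  have hπ : Function.Surjective π := by
    intro q
    induction q using QuotientAddGroup.induction_on with
    | H a => exact ⟨QuotientAddGroup.mk a, rfl⟩
  exact Finite.of_surjective π hπ

/-- **`ker g_0` is finite once `𝒦_{v,0}[p^∞]` is finite at the bad places and at the places above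
`p`.** For an elliptic curve `E` over a number field `K` and any `ℤ_p`-extension `κ`: if the
`p`-power torsion of the level-`0` local tower kernel is finite at every finite place `v` with
`v ∣ p` or of bad reduction (a finite set, `finite_badPlaces_holds`), then
`A_0 / Sel_{p^∞}(E/K_0)` is finite — at the remaining places `𝒦_{v,0}[p^∞] = 0`
(`localTowerKerPrimary_zero_eq_bot_of_hasGoodReductionAt`). Greenberg, LNM 1716, §3, p. 90
(`Σ₀ = {v ∣ p} ∪ {bad v}`; Lemmas 3.3–3.5 at `n = 0`).
[cite: GreenbergLNM1716, §3 Lemma 3.5 (proof, p. 90)] -/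
theorem finite_kerG_zero_of_local_finiteness [W.IsElliptic]
    (hfin : ∀ v : HeightOneSpectrum (𝓞 K), ((p : 𝓞 K) ∈ v.asIdeal ∨ ¬ W.HasGoodReductionAt v) →
      Finite (W.localTowerKerPrimary κ (v.adicCompletion K) 0)) :
    Finite (↥(W.selmerInftyPreimage κ 0) ⧸
      (W.selmerLayer κ 0).addSubgroupOf (W.selmerInftyPreimage κ 0)) := by
  -- `Σ₀ = {v ∣ p} ∪ {bad v}` is finite
  have hp0 : (Ideal.span {(p : 𝓞 K)} : Ideal (𝓞 K)) ≠ ⊥ := by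
    rw [Ne, Ideal.span_singleton_eq_bot]
    exact_mod_cast (Fact.out : p.Prime).ne_zero
  have hfinp : {v : HeightOneSpectrum (𝓞 K) | (p : 𝓞 K) ∈ v.asIdeal}.Finite := by
    refine (Ideal.finite_factors hp0).subset fun v hv ↦ ?_
    simp only [Set.mem_setOf_eq] at hv ⊢
    exact (Ideal.dvd_span_singleton).mpr hv
  have hbad : (W.badPlaces (𝓞 K)).Finite := W.finite_badPlaces_holds (𝓞 K)
  let S : Finset (HeightOneSpectrum (𝓞 K)) := (hfinp.union hbad).toFinset
  have hS : ∀ v : HeightOneSpectrum (𝓞 K),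
      v ∈ S ↔ (p : 𝓞 K) ∈ v.asIdeal ∨ ¬ W.HasGoodReductionAt v := fun v ↦ by
    simp only [S, Set.Finite.mem_toFinset, Set.mem_union, Set.mem_setOf_eq,
      WeierstrassCurve.mem_badPlaces_iff]
  refine W.finite_kerG_zero_of_localTowerKerPrimary κ S (fun v hv ↦ ?_) (fun v hv ↦ ?_)
  · rw [hS, not_or, not_not] at hv
    exact W.localTowerKerPrimary_zero_eq_bot_of_hasGoodReductionAt κ v hv.1 hv.2
  · exact hfin v ((hS v).mp hv)

end WeierstrassCurve

/-! ## The `K = ℚ` fact from the layer `n = 0` -/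

namespace Literature.NumberTheory.EllipticCurves

open IwasawaAlgebra

/-- **`Greenberg1999_coinvariantsRank_eq_selmerCorank_rat` from the finiteness of `ker g_0`
alone.** If for every elliptic curve `E/ℚ`, every prime `p` and the cyclotomic `ℤ_p`-extension
`κ`, good ordinary reduction above `p` (place-wise: `HasGoodReductionAt v ∧ HasUnitRootAt v` for
`v ∣ p`) makes `ker g_0 = A_0 / Sel_{p^∞}(E/ℚ)` finite, then the `K = ℚ` fact holds: the
BSD-style hypotheses give the place-wise ones (`hasGoodReductionAt_and_hasUnitRootAt_of_rat`),
`coker s_0` is a quotient of `ker g_0` by the snake sequence and Lemma 3.2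
(`finite_coker_and_card_le` at `n = 0`, with `Greenberg1999_layerInvariants_le_range_holds`), and
the identity only needs `coker s_0` finite
(`finite_and_coinvariantsRank_eq_selmerCorank_of_finite_coker`). Greenberg, LNM 1716, Thm. 1.2,
§1 pp. 60, 65; §3 p. 86 (snake sequence) and p. 90 ("Lemmas 3.2 and 3.5 show that `coker(s_n)` is
finite"). [cite: GreenbergLNM1716, Thm 1.2 and §1 pp. 60, 65] -/
theorem Greenberg1999_coinvariantsRank_eq_selmerCorank_rat_of_finite_kerG_zero
    (h0 : ∀ (W : WeierstrassCurve ℚ) [W.IsElliptic] {p : ℕ} [Fact p.Prime] (κ : ZpExtension ℚ p),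
      κ.IsCyclotomic →
      (∀ v : HeightOneSpectrum (𝓞 ℚ), (p : 𝓞 ℚ) ∈ v.asIdeal →
        W.HasGoodReductionAt v ∧ W.HasUnitRootAt v) →
      Finite (↥(W.selmerInftyPreimage κ 0) ⧸
        (W.selmerLayer κ 0).addSubgroupOf (W.selmerInftyPreimage κ 0))) :
    Greenberg1999_coinvariantsRank_eq_selmerCorank_rat := by
  intro W _ _ p _ hgood hord κ γ hκ hγ D
  haveI := h0 W κ hκ (W.hasGoodReductionAt_and_hasUnitRootAt_of_rat hgood hord)
  exact W.finite_and_coinvariantsRank_eq_selmerCorank_of_finite_coker hκ hγ D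
    (W.finite_coker_and_card_le κ (W.Greenberg1999_layerInvariants_le_range_holds κ) hκ 0).1

/-- **`Greenberg1999_coinvariantsRank_eq_selmerCorank_rat` from the two level-`0` local
finiteness statements** (what remains of Greenberg's Lemmas 3.3 and 3.4 for this fact): for
`E/ℚ` elliptic, `p` prime, `κ` the cyclotomic `ℤ_p`-extension of `ℚ`,
* (hbad) at a place `v ∤ p` of bad reduction, `𝒦_{v,0}[p^∞]` is finite (Lemma 3.3, eq. (4),
  p. 87, at `n = 0`: `#ker(r_v) ≤ #B_v/(B_v)_div`);
* (hp) at `v ∣ p` of good ordinary reduction, `𝒦_{v,0}[p^∞]` is finite (Lemma 3.4, p. 89, at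
  `n = 0`: `#ker(r_v) = #Ẽ(f_v)(p)²`).
Then the `K = ℚ` fact holds (`finite_kerG_zero_of_local_finiteness`, the good places `v ∤ p`
being settled by `localTowerKerPrimary_zero_eq_bot_of_hasGoodReductionAt`, and
`Greenberg1999_coinvariantsRank_eq_selmerCorank_rat_of_finite_kerG_zero`). Greenberg, LNM 1716,
§3 pp. 87–90. [cite: GreenbergLNM1716, §3 Lemmas 3.3–3.5 (pp. 87–90)] -/
theorem Greenberg1999_coinvariantsRank_eq_selmerCorank_rat_of_local_finiteness
    (hbad : ∀ (W : WeierstrassCurve ℚ) [W.IsElliptic] {p : ℕ} [Fact p.Prime] (κ : ZpExtension ℚ p),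
      κ.IsCyclotomic → ∀ v : HeightOneSpectrum (𝓞 ℚ), (p : 𝓞 ℚ) ∉ v.asIdeal →
        ¬ W.HasGoodReductionAt v → Finite (W.localTowerKerPrimary κ (v.adicCompletion ℚ) 0))
    (hp : ∀ (W : WeierstrassCurve ℚ) [W.IsElliptic] {p : ℕ} [Fact p.Prime] (κ : ZpExtension ℚ p),
      κ.IsCyclotomic → ∀ v : HeightOneSpectrum (𝓞 ℚ), (p : 𝓞 ℚ) ∈ v.asIdeal →
        W.HasGoodReductionAt v → W.HasUnitRootAt v →
          Finite (W.localTowerKerPrimary κ (v.adicCompletion ℚ) 0)) :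
    Greenberg1999_coinvariantsRank_eq_selmerCorank_rat := by
  refine Greenberg1999_coinvariantsRank_eq_selmerCorank_rat_of_finite_kerG_zero
    fun W _ p _ κ hκ hpl ↦ ?_
  refine W.finite_kerG_zero_of_local_finiteness κ fun v hv ↦ ?_
  by_cases hpv : (p : 𝓞 ℚ) ∈ v.asIdeal
  · exact hp W κ hκ v hpv (hpl v hpv).1 (hpl v hpv).2
  · exact hbad W κ hκ v hpv (hv.resolve_left hpv)

end Literature.NumberTheory.EllipticCurves

end
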